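import Mathlib

/-!
# `TateFamilyKernelCurves` (stmt-KontsevichZagierPeriods-9132), line `Sketch` — stub `stub_complexPartialFractions`

HERMITE REDUCTION WITH RESIDUES over `ℚ̄ ⊂ ℂ`, in denominator-free form. For `p q : ℂ[X]` with
algebraic coefficients, `q ≠ 0`, there are `R : ℂ[X]` with algebraic coefficients and algebraic
residues `A ρ` at the (algebraic) roots `ρ` of `q` such that
`p * q = R′ * q − R * q′ + q * Σ_{ρ} C (A ρ) * (q /ₘ (X − C ρ))`,
i.e. `p/q = (R/q)′ + Σ_ρ A_ρ/(X − ρ)` away from the roots.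

Proof outline:
* over an arbitrary field `K` of characteristic zero, given a factorisation
  `q = C a * ∏_{ρ ∈ s} (X − C ρ) ^ n ρ`, the denominator-free partial fraction decomposition
  `Polynomial.eq_quo_mul_prod_pow_add_sum_rem_mul_prod_pow` writes `p` as a polynomial multiple of
  `∏ (X − C ρ) ^ n ρ` plus constants times `(X − C ρ) ^ j * ∏_{k ≠ ρ} (X − C k) ^ n k` (`j < n ρ`);
  the set of `p` admitting a Hermite reduction is additively closed, the polynomial part is exact
  (polynomials have primitives in characteristic zero), the pieces with `j + 1 < n ρ` are exact
  (an explicit primitive, checked by `ring`), and the pieces with `j + 1 = n ρ` are the residues;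
* over an algebraically closed field of characteristic zero the factorisation over the distinct
  roots is `Polynomial.C_leadingCoeff_mul_prod_multiset_X_sub_C`;
* descent: apply this to `K := algebraicClosure ℚ ℂ` (algebraically closed), lifting `p, q` to
  `K[X]` coefficientwise and mapping the identity back along `algebraMap K ℂ`; all algebraicity
  clauses are then automatic.
-/

noncomputable section

open Polynomial

namespace Summit.KontsevichZagierPeriods.InverseLandau

/-- In characteristic zero every polynomial has a polynomial primitive. [folklore] -/
theorem cpf_exists_antideriv {K : Type*} [Field K] [CharZero K] (Q : K[X]) :
    ∃ S : K[X], derivative S = Q := by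
  induction Q using Polynomial.induction_on' with
  | add p q hp hq =>
    obtain ⟨S, hS⟩ := hp
    obtain ⟨T, hT⟩ := hq
    exact ⟨S + T, by rw [derivative_add, hS, hT]⟩
  | monomial n a =>
    refine ⟨monomial (n + 1) (a / (n + 1)), ?_⟩
    rw [derivative_monomial_succ, div_mul_cancel₀]
    exact Nat.cast_add_one_ne_zero n

/-- The exactness of a higher-order polar piece, denominator-free:
with `q = C a * (X - C ρ) ^ m * v` and `R = C (c / (j + 1 - m)) * (X - C ρ) ^ (j + 1) * v` one has
`(C c * (X - C ρ) ^ j * v) * q = R′ * q - R * q′` (i.e. `c (X - ρ)^(j-m) = (R/q)′`). [folklore] -/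
theorem cpf_exact_piece {K : Type*} [Field K] (c ρ a : K) (v : K[X]) (j m : ℕ)
    (h : (j : K) + 1 - m ≠ 0) :
    C c * (X - C ρ) ^ j * v * (C a * (X - C ρ) ^ m * v) =
      derivative (C (c / ((j : K) + 1 - m)) * (X - C ρ) ^ (j + 1) * v) *
          (C a * (X - C ρ) ^ m * v) -
        C (c / ((j : K) + 1 - m)) * (X - C ρ) ^ (j + 1) * v *
          derivative (C a * (X - C ρ) ^ m * v) := by
  have hc : C c = C (c / ((j : K) + 1 - m)) * (C (j : K) + 1 - C (m : K)) := by
    rw [← C_1, ← C_add, ← C_sub, ← C_mul, div_mul_cancel₀ c h]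
  rw [hc]
  generalize c / ((j : K) + 1 - m) = e
  rcases m with _ | m
  · simp only [pow_zero, mul_one, Nat.cast_zero, C_0, sub_zero, derivative_mul, derivative_C,
      zero_mul, zero_add, derivative_pow_succ, C_add, C_1, derivative_sub, derivative_X, mul_one]
    ring
  · simp only [Nat.cast_succ, C_add, C_1, derivative_mul, derivative_C, zero_mul, zero_add,
      derivative_pow_succ, derivative_sub, derivative_X, sub_zero, mul_one]
    ring

/-- Additivity of Hermite reductions: if `p₁` and `p₂` admit one (w.r.t. `q` and the finite set
`s`), so does `p₁ + p₂`. [folklore] -/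
theorem cpf_reduction_add {K : Type*} [Field K] (q : K[X]) (s : Finset K) {p₁ p₂ : K[X]}
    (h₁ : ∃ (R : K[X]) (A : K → K), p₁ * q = derivative R * q - R * derivative q +
        q * ∑ ρ ∈ s, C (A ρ) * (q /ₘ (X - C ρ)))
    (h₂ : ∃ (R : K[X]) (A : K → K), p₂ * q = derivative R * q - R * derivative q +
        q * ∑ ρ ∈ s, C (A ρ) * (q /ₘ (X - C ρ))) :
    ∃ (R : K[X]) (A : K → K), (p₁ + p₂) * q = derivative R * q - R * derivative q +
        q * ∑ ρ ∈ s, C (A ρ) * (q /ₘ (X - C ρ)) := by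
  obtain ⟨R₁, A₁, h₁⟩ := h₁
  obtain ⟨R₂, A₂, h₂⟩ := h₂
  refine ⟨R₁ + R₂, A₁ + A₂, ?_⟩
  rw [add_mul, h₁, h₂, derivative_add]
  simp only [Pi.add_apply, C_add, add_mul, Finset.sum_add_distrib]
  ring

/-- Hermite reductions are closed under finite sums. [folklore] -/
theorem cpf_reduction_sum {K ι : Type*} [Field K] (q : K[X]) (s : Finset K) (t : Finset ι)
    (f : ι → K[X])
    (h : ∀ i ∈ t, ∃ (R : K[X]) (A : K → K), f i * q = derivative R * q - R * derivative q +
        q * ∑ ρ ∈ s, C (A ρ) * (q /ₘ (X - C ρ))) :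
    ∃ (R : K[X]) (A : K → K), (∑ i ∈ t, f i) * q = derivative R * q - R * derivative q +
        q * ∑ ρ ∈ s, C (A ρ) * (q /ₘ (X - C ρ)) := by
  refine Finset.sum_induction f (fun p => ∃ (R : K[X]) (A : K → K),
      p * q = derivative R * q - R * derivative q + q * ∑ ρ ∈ s, C (A ρ) * (q /ₘ (X - C ρ)))
    (fun a b ha hb => cpf_reduction_add q s ha hb) ⟨0, 0, ?_⟩ h
  simp only [zero_mul, derivative_zero, sub_zero, zero_add, Pi.zero_apply, C_0,
    Finset.sum_const_zero, mul_zero]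

/-- Hermite reduction with residues over a field of characteristic zero, given a factorisation
`q = C a * ∏_{ρ ∈ s} (X - C ρ) ^ n ρ` into distinct linear factors: every `p` satisfies
`p * q = R′ * q - R * q′ + q * Σ_{ρ ∈ s} C (A ρ) * (q /ₘ (X - C ρ))` for some polynomial `R` and
constants `A ρ`. [folklore] -/
theorem cpf_hermite_of_factorisation {K : Type*} [Field K] [CharZero K] [DecidableEq K]
    (s : Finset K) (n : K → ℕ) (a : K) (ha : a ≠ 0) (q : K[X])
    (hq : q = C a * ∏ ρ ∈ s, (X - C ρ) ^ n ρ) (p : K[X]) :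
    ∃ (R : K[X]) (A : K → K), p * q = derivative R * q - R * derivative q +
      q * ∑ ρ ∈ s, C (A ρ) * (q /ₘ (X - C ρ)) := by
  obtain ⟨Q, r, hr, hp⟩ := eq_quo_mul_prod_pow_add_sum_rem_mul_prod_pow (s := s) p
    (g := fun ρ => X - C ρ) (fun ρ _ => monic_X_sub_C ρ)
    ((pairwise_coprime_X_sub_C (s := id) Function.injective_id).set_pairwise _) n
  subst hp
  refine cpf_reduction_add q s ?_
    (cpf_reduction_sum q s s _ fun i hi => cpf_reduction_sum q s _ _ fun j _ => ?_)
  · -- the polynomial part is exact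
    obtain ⟨S, hS⟩ := cpf_exists_antideriv (C a⁻¹ * Q)
    refine ⟨S * q, 0, ?_⟩
    have h1 : C a⁻¹ * q = ∏ ρ ∈ s, (X - C ρ) ^ n ρ := by
      rw [hq, ← mul_assoc, ← C_mul, inv_mul_cancel₀ ha, C_1, one_mul]
    simp only [Pi.zero_apply, C_0, zero_mul, Finset.sum_const_zero, mul_zero, add_zero,
      derivative_mul, hS]
    rw [← h1]
    ring
  · -- the polar pieces
    have hqi : q = C a * (X - C i) ^ n i * ∏ k ∈ s.erase i, (X - C k) ^ n k := by
      rw [hq, mul_assoc, Finset.mul_prod_erase s (fun ρ => (X - C ρ) ^ n ρ) hi]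
    have hjn : (j : ℕ) < n i := j.2
    have hrc : r i j = C ((r i j).coeff 0) := eq_C_of_degree_le_zero
      (Nat.WithBot.lt_one_iff_le_zero.1 (by simpa only [degree_X_sub_C] using hr i hi j))
    rw [hrc]
    generalize (r i j).coeff 0 = c
    generalize hk : (j : ℕ) = k
    rw [hk] at hjn
    rcases eq_or_ne (k + 1) (n i) with hk1 | hk1
    · -- the residue term
      refine ⟨0, Pi.single i (c / a), ?_⟩
      have hdiv : q /ₘ (X - C i) = C a * (X - C i) ^ k * ∏ k ∈ s.erase i, (X - C k) ^ n k := by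
        rw [hqi, ← hk1, pow_succ', show C a * ((X - C i) * (X - C i) ^ k) *
            ∏ k ∈ s.erase i, (X - C k) ^ n k = (X - C i) * (C a * (X - C i) ^ k *
            ∏ k ∈ s.erase i, (X - C k) ^ n k) by ring,
          mul_divByMonic_cancel_left _ (monic_X_sub_C i)]
      rw [Finset.sum_eq_single_of_mem i hi fun b _ hb => by
        rw [Pi.single_eq_of_ne hb, C_0, zero_mul], Pi.single_eq_same, hdiv,
        show C c = C (c / a) * C a by rw [← C_mul, div_mul_cancel₀ c ha]]
      simp only [derivative_zero, zero_mul, sub_zero, zero_add]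
      ring
    · -- an exact term
      have hK : ((k : ℕ) : K) + 1 - (n i : ℕ) ≠ 0 := by
        rw [sub_ne_zero]
        exact_mod_cast hk1
      refine ⟨C (c / ((k : K) + 1 - (n i : ℕ))) * (X - C i) ^ (k + 1) *
        ∏ k ∈ s.erase i, (X - C k) ^ n k, 0, ?_⟩
      simp only [Pi.zero_apply, C_0, zero_mul, Finset.sum_const_zero, mul_zero, add_zero]
      rw [hqi]
      exact cpf_exact_piece c i a _ k (n i) hK

/-- Hermite reduction with residues over an algebraically closed field of characteristic zero:
`p * q = R′ * q - R * q′ + q * Σ_{ρ ∈ roots q} C (A ρ) * (q /ₘ (X - C ρ))`. [folklore] -/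
theorem cpf_hermite {K : Type*} [Field K] [CharZero K] [IsAlgClosed K] [DecidableEq K]
    (p q : K[X]) (hq : q ≠ 0) :
    ∃ (R : K[X]) (A : K → K), p * q = derivative R * q - R * derivative q +
      q * ∑ ρ ∈ q.roots.toFinset, C (A ρ) * (q /ₘ (X - C ρ)) := by
  refine cpf_hermite_of_factorisation q.roots.toFinset (fun ρ => q.roots.count ρ) q.leadingCoeff
    (leadingCoeff_ne_zero.2 hq) q ?_ p
  rw [← Finset.prod_multiset_map_count q.roots (fun ρ => X - C ρ),
    C_leadingCoeff_mul_prod_multiset_X_sub_C IsAlgClosed.card_roots_eq_natDegree]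

/-- **Hermite reduction with residues over `ℚ̄ ⊂ ℂ`.** For `p, q ∈ ℂ[X]` with algebraic
coefficients, `q ≠ 0`, there are `R ∈ ℂ[X]` with algebraic coefficients and algebraic residues
`A ρ` at the (algebraic) roots `ρ` of `q` with
`p·q = R′·q − R·q′ + q·Σ_{ρ} A_ρ · (q /ₘ (X − ρ))` in `ℂ[X]`
(i.e. `p/q = (R/q)′ + Σ_ρ A_ρ/(X − ρ)` off the roots). Obtained from `cpf_hermite` over the
algebraically closed field `algebraicClosure ℚ ℂ` by base change along its embedding into `ℂ`.
[cite: KontsevichZagier2001, §1.2] -/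
theorem stub_complexPartialFractions : ∀ (p q : Polynomial ℂ), q ≠ 0 →
    (∀ n, IsAlgebraic ℚ (p.coeff n)) → (∀ n, IsAlgebraic ℚ (q.coeff n)) →
    ∃ (R : Polynomial ℂ) (A : ℂ → ℂ), (∀ n, IsAlgebraic ℚ (R.coeff n)) ∧
      (∀ ρ ∈ q.roots, IsAlgebraic ℚ ρ ∧ IsAlgebraic ℚ (A ρ)) ∧
      p * q = derivative R * q - R * derivative q +
        q * ∑ ρ ∈ q.roots.toFinset, C (A ρ) * (q /ₘ (X - C ρ)) := by
  intro p q hq hp hqa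
  haveI : IsAlgClosed (algebraicClosure ℚ ℂ) := (algebraicClosure.isAlgClosure ℚ ℂ).isAlgClosed
  have hf : Function.Injective (algebraMap (algebraicClosure ℚ ℂ) ℂ) :=
    (algebraMap (algebraicClosure ℚ ℂ) ℂ).injective
  have hlift : ∀ r : ℂ[X], (∀ n, IsAlgebraic ℚ (r.coeff n)) →
      ∃ rK : (algebraicClosure ℚ ℂ)[X], rK.map (algebraMap (algebraicClosure ℚ ℂ) ℂ) = r := by
    intro r hr
    exact (Polynomial.mem_lifts r).1 ((Polynomial.lifts_iff_coeff_lifts r).2 fun n =>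
      ⟨⟨r.coeff n, mem_algebraicClosure_iff.2 (hr n)⟩, rfl⟩)
  obtain ⟨pK, rfl⟩ := hlift p hp
  obtain ⟨qK, rfl⟩ := hlift q hqa
  have hqK : qK ≠ 0 := by
    rintro rfl
    exact hq (Polynomial.map_zero _)
  obtain ⟨RK, AK, hid⟩ := cpf_hermite pK qK hqK
  have hroots : (qK.map (algebraMap (algebraicClosure ℚ ℂ) ℂ)).roots =
      qK.roots.map (algebraMap (algebraicClosure ℚ ℂ) ℂ) :=
    (roots_map_of_injective_of_card_eq_natDegree hf IsAlgClosed.card_roots_eq_natDegree).symm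
  refine ⟨RK.map (algebraMap (algebraicClosure ℚ ℂ) ℂ),
    Function.extend (algebraMap (algebraicClosure ℚ ℂ) ℂ)
      (fun x => algebraMap (algebraicClosure ℚ ℂ) ℂ (AK x)) 0, ?_, ?_, ?_⟩
  · intro n
    rw [coeff_map]
    exact mem_algebraicClosure_iff.1 (RK.coeff n).2
  · intro ρ hρ
    rw [hroots, Multiset.mem_map] at hρ
    obtain ⟨ρK, -, rfl⟩ := hρ
    rw [hf.extend_apply]
    exact ⟨mem_algebraicClosure_iff.1 ρK.2, mem_algebraicClosure_iff.1 (AK ρK).2⟩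
  · have := congrArg (Polynomial.map (algebraMap (algebraicClosure ℚ ℂ) ℂ)) hid
    simp only [Polynomial.map_mul, Polynomial.map_sub, Polynomial.map_add, ← derivative_map,
      Polynomial.map_sum, Polynomial.map_C, Polynomial.map_divByMonic _ (monic_X_sub_C _),
      Polynomial.map_X] at this
    rw [this, hroots, Multiset.toFinset_map, Finset.sum_image fun x _ y _ h => hf h]
    simp only [hf.extend_apply]

end Summit.KontsevichZagierPeriods.InverseLandau

end
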